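import Mathlib
import Summits.MatrixMultiplication.MatrixMultiplication.Theorems.FidelityWitnessesFidelityGapThreeSeventeenStubBorelNormalFormOps

/-!
# Borel normal form, part 7: invariance of the matrix multiplication tensor

Support file for `stub_borelNormalForm` (line `symbolic-square-border-apolarity` of
`FidelityWitnesses.FidelityGapThreeSeventeen`).  The stabiliser acts: `⟨opL X p q f, T3⟩ = 0` for EVERY
polynomial `f` and all `X, p, q` (`tPair_opL`) — by the coefficient formula for `X_b ∂_a`, the trace form
`⟨f, T3⟩ = ∑_{ijk} [z_{ik} x_{ij} y_{jk}] f` (`tPair_T3`) and a reindexing; hence the apolar annihilator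
`S₁₁₁ ∩ ker ⟨·, T3⟩` is stable under every operator (`opL_mem_ann`) and under the weight slices of any
weight constant on the support of `T3` (`whc_mem_ann`).  PROVED; depends on the line's `…Defs`.
-/

noncomputable section

namespace Summit.MatrixMultiplication.MatrixMultiplication.Theorems.SymbolicSquare

-- single-conjunct summit: the `Summit.<S>.<P>` prefix repeats `MatrixMultiplication` by design (D-0017)
set_option linter.dupNamespace false

open scoped BigOperators Polynomial
open Polynomial

/-! ## Invariance of the tensor: `⟨D f, T3⟩ = 0` for every operator `D` and every `f` -/

section Tau

open BorelLimit

/-- Coefficient extraction for `X_b ∂_a`. -/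
theorem coeff_xd_eq (b a : Var) (f : Poly) (d : Var →₀ ℕ) :
    MvPolynomial.coeff d (xd b a f) = if d b = 0 then 0 else
      MvPolynomial.coeff (d - Finsupp.single b 1 + Finsupp.single a 1) f *
        ((((d - Finsupp.single b 1 : Var →₀ ℕ) a : ℕ) : ℂ) + 1) := by
  classical
  rw [xd_apply, MvPolynomial.coeff_X_mul', MvPolynomial.coeff_pderiv]
  by_cases h : d b = 0
  · rw [if_neg (by simpa using h), if_pos h]
  · rw [if_pos (by simpa using h), if_neg h]

/-- Values of the multilinear exponent `ms a b c`. -/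
theorem ms_apply (a b c : P3) (v : Var) :
    ms a b c v = (if v = (2, a) then 1 else 0) + (if v = (0, b) then 1 else 0) + (if v = (1, c) then 1 else 0) := by
  simp only [ms, Finsupp.coe_add, Pi.add_apply, Finsupp.single_apply]
  congr 1 <;> [congr 1; skip] <;> simp [eq_comm]

/-- Moving the `x`-variable of a multilinear monomial: coefficient form. -/
theorem coeff_ms_xd0 (a b c b₁ b₂ : P3) (f : Poly) :
    MvPolynomial.coeff (ms a b c) (xd ((0 : Fin 3), b₁) ((0 : Fin 3), b₂) f) =
      if b = b₁ then MvPolynomial.coeff (ms a b₂ c) f else 0 := by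
  rw [coeff_xd_eq]
  by_cases hb : b = b₁
  · subst hb
    have h1 : ms a b c ((0 : Fin 3), b) ≠ 0 := by simp [ms_apply]
    have e1 : ms a b c - Finsupp.single ((0 : Fin 3), b) 1 =
        Finsupp.single ((2 : Fin 3), a) 1 + Finsupp.single ((1 : Fin 3), c) 1 := by
      rw [ms, add_right_comm, add_tsub_cancel_right]
    have e2 : Finsupp.single ((2 : Fin 3), a) 1 + Finsupp.single ((1 : Fin 3), c) 1 +
        Finsupp.single ((0 : Fin 3), b₂) 1 = ms a b₂ c := by rw [ms, add_right_comm]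
    have e3 : (Finsupp.single ((2 : Fin 3), a) 1 + Finsupp.single ((1 : Fin 3), c) 1 : Var →₀ ℕ)
        ((0 : Fin 3), b₂) = 0 := by simp
    rw [if_neg h1, if_pos rfl, e1, e2, e3]
    simp
  · have h0 : ms a b c ((0 : Fin 3), b₁) = 0 := by
      simp [ms_apply, Ne.symm hb]
    rw [if_pos h0, if_neg hb]

/-- Moving the `y`-variable of a multilinear monomial: coefficient form. -/
theorem coeff_ms_xd1 (a b c c₁ c₂ : P3) (f : Poly) :
    MvPolynomial.coeff (ms a b c) (xd ((1 : Fin 3), c₁) ((1 : Fin 3), c₂) f) =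
      if c = c₁ then MvPolynomial.coeff (ms a b c₂) f else 0 := by
  rw [coeff_xd_eq]
  by_cases hc : c = c₁
  · subst hc
    have h1 : ms a b c ((1 : Fin 3), c) ≠ 0 := by simp [ms_apply]
    have e1 : ms a b c - Finsupp.single ((1 : Fin 3), c) 1 =
        Finsupp.single ((2 : Fin 3), a) 1 + Finsupp.single ((0 : Fin 3), b) 1 := by
      rw [ms, add_tsub_cancel_right]
    have e2 : Finsupp.single ((2 : Fin 3), a) 1 + Finsupp.single ((0 : Fin 3), b) 1 +
        Finsupp.single ((1 : Fin 3), c₂) 1 = ms a b c₂ := rfl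
    have e3 : (Finsupp.single ((2 : Fin 3), a) 1 + Finsupp.single ((0 : Fin 3), b) 1 : Var →₀ ℕ)
        ((1 : Fin 3), c₂) = 0 := by simp
    rw [if_neg h1, if_pos rfl, e1, e2, e3]
    simp
  · have h0 : ms a b c ((1 : Fin 3), c₁) = 0 := by
      simp [ms_apply, Ne.symm hc]
    rw [if_pos h0, if_neg hc]

/-- Moving the `z`-variable of a multilinear monomial: coefficient form. -/
theorem coeff_ms_xd2 (a b c a₁ a₂ : P3) (f : Poly) :
    MvPolynomial.coeff (ms a b c) (xd ((2 : Fin 3), a₁) ((2 : Fin 3), a₂) f) =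
      if a = a₁ then MvPolynomial.coeff (ms a₂ b c) f else 0 := by
  rw [coeff_xd_eq]
  by_cases ha : a = a₁
  · subst ha
    have h1 : ms a b c ((2 : Fin 3), a) ≠ 0 := by simp [ms_apply]
    have e1 : ms a b c - Finsupp.single ((2 : Fin 3), a) 1 =
        Finsupp.single ((0 : Fin 3), b) 1 + Finsupp.single ((1 : Fin 3), c) 1 := by
      rw [ms, add_assoc, add_comm, add_tsub_cancel_right]
    have e2 : Finsupp.single ((0 : Fin 3), b) 1 + Finsupp.single ((1 : Fin 3), c) 1 +
        Finsupp.single ((2 : Fin 3), a₂) 1 = ms a₂ b c := by rw [ms, add_comm, add_assoc]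
    have e3 : (Finsupp.single ((0 : Fin 3), b) 1 + Finsupp.single ((1 : Fin 3), c) 1 : Var →₀ ℕ)
        ((2 : Fin 3), a₂) = 0 := by simp
    rw [if_neg h1, if_pos rfl, e1, e2, e3]
    simp
  · have h0 : ms a b c ((2 : Fin 3), a₁) = 0 := by
      simp [ms_apply, Ne.symm ha]
    rw [if_pos h0, if_neg ha]

/-- **`⟨f, T3⟩` is the trace** `∑_{i,j,k} [z_{ik} x_{ij} y_{jk}] f`. -/
theorem tPair_T3 (f : Poly) :
    tPair T3 f = ∑ i : Fin 3, ∑ j : Fin 3, ∑ k : Fin 3, MvPolynomial.coeff (ms (i, k) (i, j) (j, k)) f := by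
  classical
  rw [tPair_eq_sum]
  -- both sides as sums over a product type
  have hL : ∑ a : P3, ∑ b : P3, ∑ c : P3, MvPolynomial.coeff (ms a b c) f * T3 a b c =
      ∑ x : P3 × P3 × P3, MvPolynomial.coeff (ms x.1 x.2.1 x.2.2) f * T3 x.1 x.2.1 x.2.2 := by
    symm
    rw [Fintype.sum_prod_type]
    refine Finset.sum_congr rfl fun a _ => ?_
    rw [Fintype.sum_prod_type]
  have hR : ∑ i : Fin 3, ∑ j : Fin 3, ∑ k : Fin 3, MvPolynomial.coeff (ms (i, k) (i, j) (j, k)) f =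
      ∑ y : Fin 3 × Fin 3 × Fin 3, MvPolynomial.coeff (ms (y.1, y.2.2) (y.1, y.2.1) (y.2.1, y.2.2)) f := by
    symm
    rw [Fintype.sum_prod_type]
    refine Finset.sum_congr rfl fun i _ => ?_
    rw [Fintype.sum_prod_type]
  rw [hL, hR]
  have hT : ∀ x : P3 × P3 × P3, MvPolynomial.coeff (ms x.1 x.2.1 x.2.2) f * T3 x.1 x.2.1 x.2.2 =
      if x.1.1 = x.2.1.1 ∧ x.2.1.2 = x.2.2.1 ∧ x.1.2 = x.2.2.2 then MvPolynomial.coeff (ms x.1 x.2.1 x.2.2) f else 0 := by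
    intro x
    simp only [T3, Literature.Computability.AlgebraicComplexity.matMulTensor, mul_ite, mul_one, mul_zero]
  simp_rw [hT]
  rw [← Finset.sum_filter]
  symm
  refine Finset.sum_nbij' (fun y => ((y.1, y.2.2), (y.1, y.2.1), (y.2.1, y.2.2)))
    (fun x => (x.1.1, x.2.1.2, x.1.2)) ?_ ?_ ?_ ?_ ?_
  · intro y _
    simp
  · intro x hx
    simp
  · intro y _
    simp
  · intro x hx
    simp only [Finset.mem_filter, Finset.mem_univ, true_and] at hx
    obtain ⟨h1, h2, h3⟩ := hx
    ext <;> simp [h1, h2, h3]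
  · intro y _
    rfl

/-- Eliminating a paired index. -/
theorem sum_ite_pair_fst {M : Type*} [AddCommMonoid M] (i q j : Fin 3) (g : Fin 3 → M) :
    (∑ j' : Fin 3, if ((i, j) : P3) = (q, j') then g j' else 0) = if i = q then g j else 0 := by
  simp only [Prod.mk.injEq]
  by_cases hi : i = q
  · simp [hi, Finset.sum_ite_eq]
  · simp [hi]

/-- Eliminating a paired index (second component fixed). -/
theorem sum_ite_pair_snd {M : Type*} [AddCommMonoid M] (i j p : Fin 3) (g : Fin 3 → M) :
    (∑ i' : Fin 3, if ((i, j) : P3) = (i', p) then g i' else 0) = if j = p then g i else 0 := by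
  simp only [Prod.mk.injEq]
  by_cases hj : j = p
  · simp [hj, Finset.sum_ite_eq]
  · simp [hj]

/-- **Invariance of `T3` under `𝔤𝔩(U)`**: `⟨opU p q f, T3⟩ = 0`. -/
theorem tPair_opL0 (p q : Fin 3) (f : Poly) : tPair T3 (opL 0 p q f) = 0 := by
  classical
  rw [tPair_T3]
  have hc : ∀ i j k : Fin 3, MvPolynomial.coeff (ms (i, k) (i, j) (j, k)) (opL 0 p q f) =
      (if i = q then MvPolynomial.coeff (ms (i, k) (p, j) (j, k)) f else 0) -
        (if i = p then MvPolynomial.coeff (ms (q, k) (i, j) (j, k)) f else 0) := by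
    intro i j k
    rw [opL, lvf_apply, MvPolynomial.coeff_sum, Fintype.sum_sum_type]
    simp only [opc, opb, opa, Matrix.cons_val_zero, Sum.elim_inl, Sum.elim_inr, MvPolynomial.coeff_smul, smul_eq_mul,
      one_mul, neg_mul, one_mul, Finset.sum_neg_distrib, coeff_ms_xd0, coeff_ms_xd2]
    rw [sum_ite_pair_fst, sum_ite_pair_fst, sub_eq_add_neg]
  simp_rw [hc, Finset.sum_sub_distrib]
  rw [sub_eq_zero]
  rw [Finset.sum_comm]
  conv_rhs => rw [Finset.sum_comm]
  simp [Finset.sum_ite_eq']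

/-- **Invariance of `T3` under `𝔤𝔩(V)`**: `⟨opV p q f, T3⟩ = 0`. -/
theorem tPair_opL1 (p q : Fin 3) (f : Poly) : tPair T3 (opL 1 p q f) = 0 := by
  classical
  rw [tPair_T3]
  have hc : ∀ i j k : Fin 3, MvPolynomial.coeff (ms (i, k) (i, j) (j, k)) (opL 1 p q f) =
      -(if j = p then MvPolynomial.coeff (ms (i, k) (i, q) (j, k)) f else 0) +
        (if j = q then MvPolynomial.coeff (ms (i, k) (i, j) (p, k)) f else 0) := by
    intro i j k
    rw [opL, lvf_apply, MvPolynomial.coeff_sum, Fintype.sum_sum_type]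
    simp only [opc, opb, opa, Matrix.cons_val_zero, Matrix.cons_val_one, Sum.elim_inl, Sum.elim_inr,
      MvPolynomial.coeff_smul, smul_eq_mul, one_mul, neg_mul, one_mul, Finset.sum_neg_distrib, coeff_ms_xd0,
      coeff_ms_xd1]
    rw [sum_ite_pair_snd, sum_ite_pair_fst]
  simp_rw [hc, Finset.sum_add_distrib, Finset.sum_neg_distrib]
  rw [neg_add_eq_zero]
  refine Finset.sum_congr rfl fun i _ => ?_
  rw [Finset.sum_comm]
  conv_rhs => rw [Finset.sum_comm]
  simp [Finset.sum_ite_eq']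

/-- **Invariance of `T3` under `𝔤𝔩(W)`**: `⟨opW p q f, T3⟩ = 0`. -/
theorem tPair_opL2 (p q : Fin 3) (f : Poly) : tPair T3 (opL 2 p q f) = 0 := by
  classical
  rw [tPair_T3]
  have hc : ∀ i j k : Fin 3, MvPolynomial.coeff (ms (i, k) (i, j) (j, k)) (opL 2 p q f) =
      -(if k = p then MvPolynomial.coeff (ms (i, k) (i, j) (j, q)) f else 0) +
        (if k = q then MvPolynomial.coeff (ms (i, p) (i, j) (j, k)) f else 0) := by
    intro i j k
    rw [opL, lvf_apply, MvPolynomial.coeff_sum, Fintype.sum_sum_type]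
    simp only [opc, opb, opa, Matrix.cons_val_two, Matrix.head_cons, Matrix.tail_cons, Sum.elim_inl, Sum.elim_inr,
      MvPolynomial.coeff_smul, smul_eq_mul, one_mul, neg_mul, one_mul, Finset.sum_neg_distrib, coeff_ms_xd1,
      coeff_ms_xd2]
    rw [sum_ite_pair_snd, sum_ite_pair_snd]
  simp_rw [hc, Finset.sum_add_distrib, Finset.sum_neg_distrib]
  rw [neg_add_eq_zero]
  refine Finset.sum_congr rfl fun i _ => Finset.sum_congr rfl fun j _ => ?_
  simp [Finset.sum_ite_eq']

/-- **Invariance of `T3`**: `⟨opL X p q f, T3⟩ = 0` for all three factors. -/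
theorem tPair_opL (X p q : Fin 3) (f : Poly) : tPair T3 (opL X p q f) = 0 := by
  fin_cases X
  · exact tPair_opL0 p q f
  · exact tPair_opL1 p q f
  · exact tPair_opL2 p q f

/-- The apolar annihilator `S_{111} ∩ ker ⟨·, T3⟩` is stable under every operator. -/
theorem opL_mem_ann (X p q : Fin 3) {f : Poly} (hf : f ∈ S m111 ⊓ LinearMap.ker (tPairL T3)) :
    opL X p q f ∈ S m111 ⊓ LinearMap.ker (tPairL T3) :=
  Submodule.mem_inf.2 ⟨opL_mem_S X p q m111 (Submodule.mem_inf.1 hf).1,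
    LinearMap.mem_ker.2 (by rw [tPairL_apply]; exact tPair_opL X p q f)⟩

/-- Weighted homogeneous pieces are stable under the weight slices of any other weight. -/
theorem whc_mem_S' (w : Var → ℕ) (m : MDeg) (j : ℕ) {f : Poly} (hf : f ∈ S m) :
    MvPolynomial.weightedHomogeneousComponent w j f ∈ S m := by
  classical
  rw [S, MvPolynomial.mem_weightedHomogeneousSubmodule] at hf ⊢
  intro d hd
  rw [MvPolynomial.coeff_weightedHomogeneousComponent] at hd
  split_ifs at hd with h
  · exact hf hd
  · exact absurd rfl hd

/-- **Weight slices of `⟨·, T3⟩`**: for weights constant `= 3` on the support of `T3`,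
`⟨f_{w = j}, T3⟩ = [j = 3] ⟨f, T3⟩`. -/
theorem tPair_whc (w : Var → ℕ) (hw : ∀ i j k : Fin 3, Finsupp.weight w (ms (i, k) (i, j) (j, k)) = 3) (j₀ : ℕ)
    (g : Poly) : tPair T3 (MvPolynomial.weightedHomogeneousComponent w j₀ g) = if j₀ = 3 then tPair T3 g else 0 := by
  classical
  rw [tPair_T3, tPair_T3]
  simp_rw [MvPolynomial.coeff_weightedHomogeneousComponent, hw]
  by_cases h : j₀ = 3
  · simp [h]
  · rw [if_neg h]
    simp [Ne.symm h]

/-- The apolar annihilator is stable under the torus weight slices. -/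
theorem whc_mem_ann (w : Var → ℕ) (hw : ∀ i j k : Fin 3, Finsupp.weight w (ms (i, k) (i, j) (j, k)) = 3) (j₀ : ℕ)
    {f : Poly} (hf : f ∈ S m111 ⊓ LinearMap.ker (tPairL T3)) :
    MvPolynomial.weightedHomogeneousComponent w j₀ f ∈ S m111 ⊓ LinearMap.ker (tPairL T3) := by
  obtain ⟨h1, h2⟩ := Submodule.mem_inf.1 hf
  rw [LinearMap.mem_ker, tPairL_apply] at h2
  refine Submodule.mem_inf.2 ⟨whc_mem_S' w m111 j₀ h1, ?_⟩
  rw [LinearMap.mem_ker, tPairL_apply, tPair_whc w hw, h2]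
  simp

end Tau


/-- **Part 7 of `stub_borelNormalForm` (registered helper stub): the matrix multiplication tensor is
invariant** — `⟨opL X p q f, T3⟩ = 0` for every polynomial `f`. -/
theorem stub_borelNormalForm_tau : ∀ (X p q : Fin 3) (f : Poly), tPair T3 (opL X p q f) = 0 :=
  fun X p q f => tPair_opL X p q f

end Summit.MatrixMultiplication.MatrixMultiplication.Theorems.SymbolicSquare

end
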